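import Summits.ABC.StewartYu.PadicG3ParVA
import HarnessLib

/-!
# The `p`-adic Gen-3 parameter record threaded through the saturated lattice `𝔑` — `PadicG3ParN` (WP-L.P(odd), rung A1.L)

Support file (one structure, plain definitions, elementary theorems; no named facts). Cell `abc-stewartyu`
(HOME `run/shared/lean/pub/abc-stewartyu/`), route `YuMatveevShapeRat`, crux `PadicCoreOddRat` (Kummer-FREE
odd-`p` core); seat p1 (record owner); design memo HOME/p1/memo/ParN-design-g10.md, kit numerics j281496
(HOME/p1/num/g10/). Frame design of record: p2's memo-07 (Θ′ = «θ-algebra, α-sizes, ξ-END»).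

THE RECORD. The M3 record `PadicG3Par n` (fields `n, p, A, Amax, W, N_q, K₀, θ₀`) with its v2 closed forms
`…V` (`PadicG3ParV/VA`, the `m = 0` family of crux `Y07Odd`) is KEPT VERBATIM as the `N`-free layer, under the
unchanged instantiation convention `N_q := K` (so `ŜG`, `yloadG`, `LgV`, `LV`, `MV`, `TV`, `W_LV`, `XV`, `XsV`, `HV`,
`S₀NV` are literally the landed quantities; the frame puts its `W̃ ≥ log max(3,|b̃ᵢ|)`, `W̃ ≥ log N` into `W`),
and ONE new datum is added: the saturation index `N = [𝔑 : ℤⁿ] ≥ 1` of the generators, with the two facts the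
frame discharges from the tree (`N ≤ (2/log 2)ⁿ·Ω` = `Dioph.natAbs_det_le_prod_height`, p515463; `log N ≤ W`).
`N` enters EXACTLY four places (Nesterenko 2003 p.107: `S = n + 24 + [log₂ N]`, (3.23), (5.5)–(5.6)):
* the depth `ŜN = n + 24 + ⌊log₂(K·N)⌋ + lgg ≥ ŜG` (END exponents are `N·λ`, one class out of `K`), hence the
  order schedule `RN/MordN` (tail sums to `ŜN`: the floor phase `TV s = 1` is longer by `≈ log₂ N` levels —
  memo-07's «reserve + (n+1)⌈log₂N⌉») and the true `Y₀`-load `yloadN` (rescaling `2^{ŜN−lev}`);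
* the `Y₀`-degree **`L₀N = ⌈6·XV·C_bⁿ·Ω·K/(g^{n−1}·N)⌉`** — DIVIDED BY `N`: the Siegel count over `𝔑` has
  `N·∏(2·sideⱼ)` unknown exponents per `ℓ₀` (tree N1 `Dioph.exists_finset_lattice_box`, p515757), and this
  slack pays the extra per-degree load `L₀N·(yloadN − yloadG) ≤ L₀N·(log N + 1)·log 2`-wise, so that the
  multiplicity scale `LgV` stays `N`-FREE (kit: with `yloadN` inside `LgV` the final bound acquires a factor
  `1 + n·log(2Amax)/(11G)`, not of shape `cⁿ·Ω·W⁺`; with `L₀` undivided the half-step fails at large heights);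
* the END box `DN j = ⌊K·N·LV/(2^{ŜN}·Aⱼ)⌋ + 1 ≤ LV/(2^{n+22}2^{lgg}) + 1` and range `XfinN = 2ⁿ·XsV ŜN/(n+1)`
  (`≥ 2^{n+22}·K·N·XV`): the scaling `K·N ↔ 2^{ŜN}` cancels exactly as `K ↔ 2^{ŜG}` did.
The multiplicity floor `2^{n+25}` of `LgV` does NOT acquire `N` (memo-07 §4 (r3)); the deep levels run with
`TV = 1` (v2 shape). This file: the structure, the closed forms, the depth and schedule laws, the `Y₀`-degree;
the END facts (box, range, (K1)/(K2)/exit A) are `PadicG3ParNA`, the budget lines follow.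

## References
* [Nesterenko2003] Yu. V. Nesterenko, *Linear forms in logarithms of rational numbers*, LNM 1819 (2003) —
  §3.3–3.5 (Prop 3.4, Prop 3.7 (3.16), (3.22)–(3.24)), (4.3)–(4.5), §5 (5.5)–(5.8), (5.12)–(5.17).
* [Yu2013] K. Yu, Acta Math. 211 (2013) — §3.1, (5.13)–(5.16), (6.12).
-/

noncomputable section

open Finset Real

namespace Summit.ABC.StewartYu

/-- **The `𝔑`-threaded `p`-adic Gen-3 record**: the M3 record `PadicG3Par n` (instantiated with `N_q := K`)
plus the saturation index `N = [𝔑 : ℤⁿ] ≥ 1` of the generators with its two frame-side facts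
`N ≤ (2/log 2)ⁿ·Ω` (Nesterenko's Prop 3.7 in the tree's sharper form) and `log N ≤ W`.
[cite: Nesterenko2003, §3.4 Prop 3.7 (3.16), §3.5 (3.24)] -/
structure PadicG3ParN (n : ℕ) extends PadicG3Par n where
  /-- the saturation index `N = [𝔑 : ℤⁿ]` -/
  N : ℕ
  hN : 1 ≤ N
  hNΩ : (N : ℝ) ≤ (2 / Real.log 2) ^ n * toPadicG3Par.Ω
  hNW : Real.log N ≤ toPadicG3Par.W

namespace PadicG3ParN

open PadicG3Par (Cb cM cG)

variable {n : ℕ} (P : PadicG3ParN n)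

/-! ### The `N`-layer: closed forms -/

/-- the depth `ŜN = n + 24 + ⌊log₂ (K·N)⌋ + lgg`. [cite: Nesterenko2003, (3.24)] -/
def SdN : ℕ := n + 24 + Nat.log 2 (P.K * P.N) + P.lgg

/-- the v1-letter depth `Ŝ′N = n + 24 + ⌊log₂ (K·N)⌋` (range scale `2^{Ŝ′N−1}` of the END). [cite: Nesterenko2003, (3.24)] -/
def SdepthN : ℕ := n + 24 + Nat.log 2 (P.K * P.N)

/-- the true `Y₀`-load `yloadN = G + 2 log p + (ŜN + n + 1) log 2 + log(n+1) + 8`. [folklore] -/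
def yloadN : ℝ := P.G + 2 * Real.log P.p + (P.SdN + n + 1) * Real.log 2 + Real.log (n + 1) + 8

/-- remaining decrements from level `s` to the END: `RN s = Σ_{s' ∈ [s, ŜN]} TV s'`. [cite: Nesterenko2003, (4.5)] -/
def RN (s : ℕ) : ℕ := ∑ s' ∈ Finset.Icc s P.SdN, P.TV s'

/-- the order at stage `(s, ν)`: `MordN s ν = MV/(n+2)³ + (n+1)·RN (s+1) + (n+1−ν)·TV s`. [cite: Nesterenko2003, (4.5)] -/
def MordN (s ν : ℕ) : ℕ := P.MV / (n + 2) ^ 3 + (n + 1) * P.RN (s + 1) + (n + 1 - ν) * P.TV s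

/-- **the `Y₀`-degree `L₀N = ⌈6 XV C_bⁿ Ω K/(g^{n−1} N)⌉`** (Siegel over `𝔑`: `÷ N`). [cite: Nesterenko2003, (3.23)] -/
def L0N : ℕ := ⌈6 * P.XV * Cb ^ n * P.Ω * P.K / (P.g ^ (n - 1) * P.N)⌉₊

/-- `D₀N = L₀N + 1`. [cite: Nesterenko2003, §5.2] -/
def D0N : ℕ := P.L0N + 1

/-- the END degrees `DN j = ⌊K·N·LV/(2^{ŜN} A j)⌋ + 1`. [cite: Nesterenko2003, (5.5)] -/
def DN (j : Fin n) : ℕ := ⌊(P.K : ℝ) * P.N * P.LV / (2 ^ P.SdN * P.A j)⌋₊ + 1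

/-- the END range `XfinN = 2ⁿ XsV ŜN/(n+1)`. [cite: Nesterenko2003, §5.2 (5.12)] -/
def XfinN : ℕ := 2 ^ n * P.XsV P.SdN / (n + 1)

/-! ### Elementary facts: `N` -/

/-- `1 ≤ N` (real). [folklore] -/
theorem one_le_N : (1 : ℝ) ≤ P.N := by exact_mod_cast P.hN

/-- `0 < N` (real). [folklore] -/
theorem N_pos : (0 : ℝ) < P.N := lt_of_lt_of_le one_pos P.one_le_N

/-- `0 ≤ log N`. [folklore] -/
theorem log_N_nonneg : 0 ≤ Real.log P.N := Real.log_nonneg P.one_le_N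

/-- `1 ≤ K·N`. [folklore] -/
theorem one_le_KN : 1 ≤ P.K * P.N := Nat.mul_pos P.one_le_K P.hN

/-! ### The depth -/

/-- `2^{ŜN} ≤ 2^{n+24} · K · N · 2^{lgg}`. [cite: Nesterenko2003, (5.6)] -/
theorem two_pow_SdN_le : 2 ^ P.SdN ≤ 2 ^ (n + 24) * (P.K * P.N) * 2 ^ P.lgg := by
  have h : 2 ^ Nat.log 2 (P.K * P.N) ≤ P.K * P.N :=
    Nat.pow_log_le_self 2 (Nat.one_le_iff_ne_zero.mp P.one_le_KN)
  have e : 2 ^ P.SdN = 2 ^ (n + 24) * 2 ^ Nat.log 2 (P.K * P.N) * 2 ^ P.lgg := by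
    unfold SdN; rw [← pow_add, ← pow_add]
  rw [e]
  exact Nat.mul_le_mul_right _ (Nat.mul_le_mul_left _ h)

/-- `2^{n+23} · K · N · 2^{lgg} < 2^{ŜN}`. [folklore] -/
theorem lt_two_pow_SdN : 2 ^ (n + 23) * (P.K * P.N) * 2 ^ P.lgg < 2 ^ P.SdN := by
  have h := Nat.lt_pow_succ_log_self (b := 2) (by norm_num) (P.K * P.N)
  have e : 2 ^ P.SdN = 2 ^ (n + 24) * 2 ^ Nat.log 2 (P.K * P.N) * 2 ^ P.lgg := by
    unfold SdN; rw [← pow_add, ← pow_add]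
  rw [e]
  refine Nat.mul_lt_mul_of_pos_right ?_ (Nat.two_pow_pos _)
  calc 2 ^ (n + 23) * (P.K * P.N) < 2 ^ (n + 23) * 2 ^ (Nat.log 2 (P.K * P.N) + 1) :=
        Nat.mul_lt_mul_of_pos_left h (Nat.two_pow_pos _)
    _ = 2 ^ (n + 24) * 2 ^ Nat.log 2 (P.K * P.N) := by ring

/-- `ŜN = Ŝ′N + lgg`. [folklore] -/
theorem SdN_eq : P.SdN = P.SdepthN + P.lgg := rfl

/-- `2^{n+22} · K < 2^{Ŝ′N − 1}` (the END range scale exceeds the class count; `N ≥ 1`). [folklore] -/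
theorem two_pow_mul_K_lt_SdepthN : 2 ^ (n + 22) * P.K < 2 ^ (P.SdepthN - 1) := by
  have h := Nat.lt_pow_succ_log_self (b := 2) (by norm_num) (P.K * P.N)
  have hN := P.hN
  have e : 2 ^ (P.SdepthN - 1) = 2 ^ (n + 22) * 2 ^ (Nat.log 2 (P.K * P.N) + 1) := by
    rw [← pow_add]; unfold SdepthN; congr 1; omega
  rw [e]
  refine Nat.mul_lt_mul_of_pos_left (lt_of_le_of_lt ?_ h) (Nat.two_pow_pos _)
  exact Nat.le_mul_of_pos_right _ hN

/-- `2^{n+23} ≤ 2^{Ŝ′N − 1}`. [folklore] -/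
theorem two_pow_le_two_pow_SdepthN_pred : 2 ^ (n + 23) ≤ 2 ^ (P.SdepthN - 1) :=
  Nat.pow_le_pow_right (by norm_num) (by unfold SdepthN; omega)

/-- Under the convention `N_q = K`: **`ŜG ≤ ŜN`** (the `N`-frame descends deeper). [folklore] -/
theorem SdG_le_SdN (hNq : P.Nq = P.K) : P.SdG ≤ P.SdN := by
  unfold SdN PadicG3Par.SdG
  rw [hNq]
  have : Nat.log 2 P.K ≤ Nat.log 2 (P.K * P.N) :=
    Nat.log_mono_right (Nat.le_mul_of_pos_right _ P.hN)
  omega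

/-- Under `N_q = K`: **`ŜN ≤ ŜG + ⌊log₂ N⌋ + 1`** (memo-07's «reserve + ⌈log₂ N⌉ levels»). [folklore] -/
theorem SdN_le (hNq : P.Nq = P.K) : P.SdN ≤ P.SdG + Nat.log 2 P.N + 1 := by
  unfold SdN PadicG3Par.SdG
  rw [hNq]
  -- `log₂ (K · N) ≤ log₂ K + log₂ N + 1`
  have h1 : P.K < 2 ^ (Nat.log 2 P.K + 1) := Nat.lt_pow_succ_log_self one_lt_two _
  have h2 : P.N < 2 ^ (Nat.log 2 P.N + 1) := Nat.lt_pow_succ_log_self one_lt_two _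
  have h3 : P.K * P.N < 2 ^ (Nat.log 2 P.K + Nat.log 2 P.N + 1 + 1) := by
    calc P.K * P.N ≤ P.K * 2 ^ (Nat.log 2 P.N + 1) := Nat.mul_le_mul_left _ h2.le
      _ < 2 ^ (Nat.log 2 P.K + 1) * 2 ^ (Nat.log 2 P.N + 1) :=
          Nat.mul_lt_mul_of_pos_right h1 (Nat.two_pow_pos _)
      _ = 2 ^ (Nat.log 2 P.K + Nat.log 2 P.N + 1 + 1) := by rw [← pow_add]; ring_nf
  have := Nat.lt_succ_iff.1 (Nat.log_lt_of_lt_pow' (by omega) h3)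
  omega

/-- `yloadG ≤ yloadN ≤ yloadG + (ŜN − ŜG)·log 2` under `N_q = K`; here the upper half:
`yloadN ≤ yloadG + (⌊log₂ N⌋ + 1) log 2`. [folklore] -/
theorem yloadN_le (hNq : P.Nq = P.K) : P.yloadN ≤ P.yloadG + (Nat.log 2 P.N + 1) * Real.log 2 := by
  unfold yloadN PadicG3Par.yloadG
  have h : (P.SdN : ℝ) ≤ P.SdG + Nat.log 2 P.N + 1 := by exact_mod_cast P.SdN_le hNq
  have hl : 0 < Real.log 2 := Real.log_pos one_lt_two
  have := mul_le_mul_of_nonneg_right h hl.le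
  linarith

/-- `yloadG ≤ yloadN` under `N_q = K`. [folklore] -/
theorem yloadG_le_yloadN (hNq : P.Nq = P.K) : P.yloadG ≤ P.yloadN := by
  unfold yloadN PadicG3Par.yloadG
  have h : (P.SdG : ℝ) ≤ P.SdN := by exact_mod_cast P.SdG_le_SdN hNq
  have hl : 0 < Real.log 2 := Real.log_pos one_lt_two
  have := mul_le_mul_of_nonneg_right h hl.le
  linarith

/-- `(⌊log₂ N⌋ : ℝ) · log 2 ≤ log N ≤ W` — the extra depth is paid in the coefficient logarithm. [folklore] -/
theorem natlog_N_mul_log_two_le_W : (Nat.log 2 P.N : ℝ) * Real.log 2 ≤ P.W := by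
  have h : (2 : ℝ) ^ Nat.log 2 P.N ≤ P.N := by exact_mod_cast Nat.pow_log_le_self 2 (by have := P.hN; omega)
  have h2 : Real.log ((2 : ℝ) ^ Nat.log 2 P.N) ≤ Real.log P.N := Real.log_le_log (by positivity) h
  rw [Real.log_pow] at h2
  exact h2.trans P.hNW

/-! ### The orders: decrement and level laws (v2 shape, depth `ŜN`) -/

/-- the in-level decrement law `MordN s ν = MordN s (ν+1) + TV s` for `ν ≤ n`. [cite: Nesterenko2003, (4.5)] -/
theorem MordN_sub_succ (s ν : ℕ) (hν : ν ≤ n) : P.MordN s ν = P.MordN s (ν + 1) + P.TV s := by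
  unfold MordN
  have : n + 1 - ν = (n + 1 - (ν + 1)) + 1 := by omega
  rw [this]; ring

/-- `RN s = TV s + RN (s+1)` for `s ≤ ŜN`. [folklore] -/
theorem RN_eq_add (s : ℕ) (hs : s ≤ P.SdN) : P.RN s = P.TV s + P.RN (s + 1) := by
  unfold RN
  rw [← Finset.sum_Ioc_add_eq_sum_Icc hs, add_comm, Finset.Icc_add_one_left_eq_Ioc]

/-- `RN s = 0` beyond the depth. [folklore] -/
theorem RN_eq_zero (s : ℕ) (hs : P.SdN < s) : P.RN s = 0 := by
  unfold RN; rw [Finset.Icc_eq_empty (by omega), Finset.sum_empty]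

/-- the level law `MordN s (n+1) = MordN (s+1) 0` for `s < ŜN`. [cite: Nesterenko2003, (4.5)] -/
theorem MordN_level (s : ℕ) (hs : s + 1 ≤ P.SdN) : P.MordN s (n + 1) = P.MordN (s + 1) 0 := by
  unfold MordN
  rw [P.RN_eq_add (s + 1) hs]
  simp only [Nat.sub_self, zero_mul, add_zero, Nat.sub_zero]
  ring

/-- `MV/(n+2)³ ≤ MordN s ν` (the reserved floor = the END multiplicity). [cite: Nesterenko2003, (4.5)] -/
theorem MV_div_le_MordN (s ν : ℕ) : P.MV / (n + 2) ^ 3 ≤ P.MordN s ν := by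
  unfold MordN; omega

/-- `RN 0 ≤ 16 LgV + ŜN + 1` (geometric part `≤ 16 LgV`, floor part `≤ ŜN + 1`). [folklore] -/
theorem RN_zero_le : P.RN 0 ≤ 16 * P.LgV + (P.SdN + 1) := by
  unfold RN PadicG3Par.TV
  have h1 : ∀ s ∈ Finset.Icc 0 P.SdN, max 1 (8 * P.LgV / 2 ^ s) ≤ 1 + 8 * P.LgV / 2 ^ s := by
    intro s _; exact max_le (Nat.le_add_right 1 _) (Nat.le_add_left _ _)
  refine (Finset.sum_le_sum h1).trans ?_
  rw [Finset.sum_add_distrib, Finset.sum_const, Nat.card_Icc, smul_eq_mul, mul_one]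
  have h2 : ∑ s ∈ Finset.Icc 0 P.SdN, 8 * P.LgV / 2 ^ s ≤ 16 * P.LgV := by
    have hr : Finset.Icc 0 P.SdN = Finset.range (P.SdN + 1) := by ext s; simp
    have hreal : ((∑ s ∈ Finset.Icc 0 P.SdN, 8 * P.LgV / 2 ^ s : ℕ) : ℝ) ≤ 16 * P.LgV := by
      rw [Nat.cast_sum]
      have hL : (0 : ℝ) ≤ P.LgV := by positivity
      calc ∑ s ∈ Finset.Icc 0 P.SdN, ((8 * P.LgV / 2 ^ s : ℕ) : ℝ)
          ≤ ∑ s ∈ Finset.Icc 0 P.SdN, (8 * (P.LgV : ℝ)) * (1 / 2) ^ s := by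
            refine Finset.sum_le_sum fun s _ => ?_
            calc ((8 * P.LgV / 2 ^ s : ℕ) : ℝ) ≤ ((8 * P.LgV : ℕ) : ℝ) / ((2 ^ s : ℕ) : ℝ) := Nat.cast_div_le
              _ = (8 * (P.LgV : ℝ)) * (1 / 2) ^ s := by push_cast; rw [one_div, inv_pow]; ring
        _ = (8 * (P.LgV : ℝ)) * ∑ s ∈ Finset.range (P.SdN + 1), (1 / 2 : ℝ) ^ s := by
            rw [← Finset.mul_sum, hr]
        _ ≤ (8 * (P.LgV : ℝ)) * 2 := mul_le_mul_of_nonneg_left (sum_geometric_two_le _) (by positivity)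
        _ = 16 * P.LgV := by ring
    exact_mod_cast hreal
  omega

/-- `MordN 0 0 = MV/(n+2)³ + (n+1) RN 0`. [folklore] -/
theorem MordN_zero_zero : P.MordN 0 0 = P.MV / (n + 2) ^ 3 + (n + 1) * P.RN 0 := by
  unfold MordN
  rw [P.RN_eq_add 0 (Nat.zero_le _)]
  simp only [Nat.sub_zero]
  ring

/-- **`MordN 0 0 ≤ MV/(n+2)³ + (n+1)(16 LgV + ŜN + 1)`**. [cite: Nesterenko2003, (3.25)] -/
theorem MordN_zero_zero_le : P.MordN 0 0 ≤ P.MV / (n + 2) ^ 3 + (n + 1) * (16 * P.LgV + (P.SdN + 1)) := by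
  rw [P.MordN_zero_zero]
  exact Nat.add_le_add_left (Nat.mul_le_mul_left _ P.RN_zero_le) _

/-- `MordN s ν ≤ MordN 0 0` (the order only decreases). [folklore] -/
theorem MordN_le_zero_zero (s ν : ℕ) : P.MordN s ν ≤ P.MordN 0 0 := by
  rw [P.MordN_zero_zero]
  unfold MordN
  have hT : (n + 1 - ν) * P.TV s ≤ (n + 1) * P.TV s := Nat.mul_le_mul_right _ (Nat.sub_le _ _)
  have hR : P.RN (s + 1) + P.TV s ≤ P.RN 0 := by
    by_cases hs : s ≤ P.SdN
    · have hsub : Finset.Icc (s + 1) P.SdN ∪ {s} ⊆ Finset.Icc 0 P.SdN := by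
        intro x hx
        simp only [Finset.mem_union, Finset.mem_Icc, Finset.mem_singleton] at hx
        simp only [Finset.mem_Icc]; omega
      have hdisj : Disjoint (Finset.Icc (s + 1) P.SdN) {s} := by
        rw [Finset.disjoint_singleton_right]; simp
      unfold RN
      calc ∑ s' ∈ Finset.Icc (s + 1) P.SdN, P.TV s' + P.TV s
          = ∑ s' ∈ Finset.Icc (s + 1) P.SdN ∪ {s}, P.TV s' := by
            rw [Finset.sum_union hdisj, Finset.sum_singleton]
        _ ≤ ∑ s' ∈ Finset.Icc 0 P.SdN, P.TV s' := Finset.sum_le_sum_of_subset hsub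
    · push Not at hs
      rw [P.RN_eq_zero (s + 1) (by omega), zero_add]
      unfold RN
      have hmem : P.SdN ∈ Finset.Icc 0 P.SdN := by simp
      have h1 : P.TV P.SdN ≤ ∑ s' ∈ Finset.Icc 0 P.SdN, P.TV s' :=
        Finset.single_le_sum (fun _ _ => Nat.zero_le _) hmem
      have h2 : P.TV s ≤ P.TV P.SdN := by
        unfold PadicG3Par.TV
        have : 8 * P.LgV / 2 ^ s ≤ 8 * P.LgV / 2 ^ P.SdN :=
          Nat.div_le_div_left (Nat.pow_le_pow_right (by norm_num) hs.le) (Nat.two_pow_pos _)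
        exact max_le_max le_rfl this
      exact h2.trans h1
  nlinarith

/-! ### The `Y₀`-degree -/

/-- `6 XV C_bⁿ Ω K/(g^{n−1} N) ≤ L₀N`. [folklore] -/
theorem L0N_ge : 6 * P.XV * Cb ^ n * P.Ω * P.K / (P.g ^ (n - 1) * P.N) ≤ P.L0N := by
  unfold L0N; exact Nat.le_ceil _

/-- `L₀N < 6 XV C_bⁿ Ω K/(g^{n−1} N) + 1`. [folklore] -/
theorem L0N_lt : (P.L0N : ℝ) < 6 * P.XV * Cb ^ n * P.Ω * P.K / (P.g ^ (n - 1) * P.N) + 1 := by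
  unfold L0N
  refine Nat.ceil_lt_add_one ?_
  have := P.Ω_pos; have := P.K_pos; have : (0:ℝ) < Cb := by unfold Cb cM; positivity
  have := lt_of_lt_of_le one_pos P.one_le_g; have := P.N_pos
  positivity

/-- **`N · L₀N < 6 XV C_bⁿ Ω K/g^{n−1} + N`**, i.e. `N·L₀N ≤ L₀V + N − 1`-wise: dividing the degree by `N`
loses nothing against the v2 degree. [folklore] -/
theorem N_mul_L0N_lt : (P.N : ℝ) * P.L0N < 6 * P.XV * Cb ^ n * P.Ω * P.K / P.g ^ (n - 1) + P.N := by
  have h := P.L0N_lt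
  have hN := P.N_pos
  have hg : 0 < P.g ^ (n - 1) := pow_pos (lt_of_lt_of_le one_pos P.one_le_g) _
  have e : (P.N : ℝ) * (6 * P.XV * Cb ^ n * P.Ω * P.K / (P.g ^ (n - 1) * P.N)) =
      6 * P.XV * Cb ^ n * P.Ω * P.K / P.g ^ (n - 1) := by
    field_simp
  have := mul_lt_mul_of_pos_left h hN
  rw [mul_add, e, mul_one] at this
  exact this

/-- `L₀N ≤ L₀V` (the `N`-degree never exceeds the v2 degree). [folklore] -/
theorem L0N_le_L0V : P.L0N ≤ P.L0V := by
  unfold L0N PadicG3Par.L0V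
  refine Nat.ceil_le_ceil ?_
  have hc : 0 ≤ 6 * P.XV * Cb ^ n * P.Ω * P.K := by
    have := P.Ω_pos; have := P.K_pos; have : (0:ℝ) < Cb := by unfold Cb cM; positivity
    positivity
  have hg : 0 < P.g ^ (n - 1) := pow_pos (lt_of_lt_of_le one_pos P.one_le_g) _
  exact div_le_div_of_nonneg_left hc hg (le_mul_of_one_le_right hg.le P.one_le_N)

/-- `1 ≤ D₀N`. [folklore] -/
theorem one_le_D0N : 1 ≤ P.D0N := by unfold D0N; omega

/-- `D₀N ≤ D₀V`. [folklore] -/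
theorem D0N_le_D0V : P.D0N ≤ P.D0V := by
  unfold D0N PadicG3Par.D0V; exact Nat.add_le_add_right P.L0N_le_L0V 1

end PadicG3ParN

end Summit.ABC.StewartYu
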